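import Literature.Computability.Complexity.HardcoreInapproximabilityGadget
import Literature.Computability.AlgebraicComplexity.MignonRessayreBound
import HarnessLib

/-!
# Short cycles of Sly's random bipartite core: vocabulary and the first moment (Sly 2010, Lemma 3.7)

Allan Sly, *Computational transition at the uniqueness threshold*, FOCS 2010 (arXiv:1005.5584), §3.2,
Lemma 3.7 (= Mossel–Weitz–Wormald 2009, Lemma 7.3): the number `X_i` of `i`-cycles inside `W` of the
random bipartite multigraph `G̃(σ, τ)` is asymptotically Poisson with mean `λ_i = r(d, i)/i`, `r(d,i)`
the number of proper `d`-edge-colourings of `C_i`. This is the first model-specific input of the small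
subgraph conditioning method behind Sly's Theorem 3.10 (the remaining input of
`slyGadgetReduction_of_thm310`).

This file sets up the vocabulary in the model of `slyCoreZ` (plus/minus copies of `Fin (n + m')`,
`W^{±}` their first `n` vertices, colour `c : Fin q` joining plus-`v` to minus-`σ c v`, the extra colour
joining plus-`s` to minus-`τ s`) and proves the FIRST-MOMENT part of Lemma 3.7 exactly and
quantitatively:

* `SlyWCycle` (rooted oriented coloured `2j`-cycles in `W`), `SlyWCycle.card_present`
  (`#{(σ,τ) ⊇ C} = Π_c (n+m'-k_c)! (n-k_τ)!` — Sly's `P1` exactly);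
* `slyRootedCycles` (`R_{2j} = 2j X_{2j}`), `avg_slyRootedCycles` (`E R_{2j} = Σ_ξ T(ξ)` over colour
  patterns `ξ`, `T(ξ) = (n^{(j)})²/(Π_c N^{(k_c)} n^{(k_τ)})`), `slyPatternTerm_bounds`
  (`((n-j)/(n+m'))^{2j} ≤ T(ξ) ≤ (n/(n-2j))^{2j}`);
* `card_slyColourPattern` (`r(q+1, 2j) = q^{2j} + q`, via the chromatic recurrence for cycles
  `card_cycleProper_succ_add` and the interleaving `slyColourPatternEquiv`);
* `avg_slyRootedCycles_bounds`: `(q^{2j}+q)((n-j)/(n+m'))^{2j} ≤ E R_{2j} ≤ (q^{2j}+q)(n/(n-2j))^{2j}`.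

Higher factorial moments (asymptotic independence / Poisson limit) are not treated here.
[cite: Sly2010, Lemma 3.7]
-/

namespace Literature.Computability.Complexity

open Finset

section Cycles

variable {n m' q j : ℕ}

/-- A **rooted oriented coloured `2j`-cycle inside `W`**: plus vertices `v_t ∈ W⁺`, minus vertices
`w_t ∈ W⁻` (both injective), the edge `v_t — w_t` has colour `a_t` and the edge `w_t — v_{t+1}` has
colour `b_t` (`none` = the extra matching `τ`), consecutive edges have different colours.
[cite: Sly2010, §3.2 (the variables `X_i`: "the number of cycles of length `i` whose vertices lie in `W`")] -/
structure SlyWCycle (n q j : ℕ) where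
  /-- plus vertices (in `W⁺ = Fin n`) [folklore] -/
  v : Fin j → Fin n
  /-- minus vertices (in `W⁻ = Fin n`) [folklore] -/
  w : Fin j → Fin n
  /-- colour of the edge `v_t — w_t` [folklore] -/
  a : Fin j → Option (Fin q)
  /-- colour of the edge `w_t — v_{t+1}` [folklore] -/
  b : Fin j → Option (Fin q)
  hv : Function.Injective v
  hw : Function.Injective w
  hab : ∀ t, a t ≠ b t
  hba : ∀ t, b t ≠ a (finRotate j t)

/-- The coloured edge `plus-s — minus-t` of colour `c` is present in the realisation `(σ, τ)`. [folklore] -/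
def SlyEdgePresent (σ : Fin q → Equiv.Perm (Fin (n + m'))) (τ : Equiv.Perm (Fin n)) (c : Option (Fin q))
    (s t : Fin n) : Prop :=
  match c with
  | none => τ s = t
  | some c => σ c (Fin.castAdd m' s) = Fin.castAdd m' t

/-- The cycle `C` is present in `G̃(σ, τ)`. [folklore] -/
def SlyWCycle.Present (C : SlyWCycle n q j) (σ : Fin q → Equiv.Perm (Fin (n + m'))) (τ : Equiv.Perm (Fin n)) : Prop :=
  (∀ t, SlyEdgePresent σ τ (C.a t) (C.v t) (C.w t)) ∧ ∀ t, SlyEdgePresent σ τ (C.b t) (C.v (finRotate j t)) (C.w t)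

end Cycles

section CycleCount

variable {n m' q j : ℕ}

/-- Permutations extending a partial injection indexed by a finset: `(card α - |E|)!` of them. [folklore] -/
theorem card_perm_forall_mem_apply_eq {ι α : Type*} [Fintype α] [DecidableEq α] (E : Finset ι) (x y : ι → α)
    (hx : Set.InjOn x E) (hy : Set.InjOn y E) :
    Fintype.card {π : Equiv.Perm α // ∀ e ∈ E, π (x e) = y e} = (Fintype.card α - E.card).factorial := by
  classical
  set e := E.equivFin.symm with he
  have hx' : Function.Injective (fun i : Fin E.card => x (e i)) := fun i i' h =>
    e.injective (Subtype.ext (hx (e i).2 (e i').2 h))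
  have hy' : Function.Injective (fun i : Fin E.card => y (e i)) := fun i i' h =>
    e.injective (Subtype.ext (hy (e i).2 (e i').2 h))
  rw [← Literature.Computability.AlgebraicComplexity.card_perm_forall_apply_eq E.card α (fun i => x (e i)) (fun i => y (e i)) hx' hy']
  refine Fintype.card_congr (Equiv.subtypeEquivRight fun π => ⟨fun h i => h _ (e i).2, fun h a ha => ?_⟩)
  have := h (e.symm ⟨a, ha⟩)
  simpa [he] using this

/-- The number of edges of colour `c` in the cycle. [folklore] -/
def SlyWCycle.colourCount (C : SlyWCycle n q j) (c : Option (Fin q)) : ℕ :=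
  (univ.filter fun t => C.a t = c).card + (univ.filter fun t => C.b t = c).card

/-- The plus endpoint of an edge of the cycle, edges indexed by `Fin j ⊕ Fin j` (`inl t` = the edge
`v_t — w_t`, `inr t` = the edge `w_t — v_{t+1}`). [folklore] -/
def SlyWCycle.plusEnd (C : SlyWCycle n q j) : Fin j ⊕ Fin j → Fin n
  | Sum.inl t => C.v t
  | Sum.inr t => C.v (finRotate j t)

/-- The minus endpoint of an edge of the cycle. [folklore] -/
def SlyWCycle.minusEnd (C : SlyWCycle n q j) : Fin j ⊕ Fin j → Fin n
  | Sum.inl t => C.w t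
  | Sum.inr t => C.w t

/-- The colour of an edge of the cycle. [folklore] -/
def SlyWCycle.colour (C : SlyWCycle n q j) : Fin j ⊕ Fin j → Option (Fin q)
  | Sum.inl t => C.a t
  | Sum.inr t => C.b t

/-- The edges of a given colour. [folklore] -/
def SlyWCycle.edgesOf (C : SlyWCycle n q j) (c : Option (Fin q)) : Finset (Fin j ⊕ Fin j) :=
  univ.filter fun e => C.colour e = c

/-- The colour class has `k_c` edges. [folklore] -/
theorem SlyWCycle.card_edgesOf (C : SlyWCycle n q j) (c : Option (Fin q)) : (C.edgesOf c).card = C.colourCount c := by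
  classical
  unfold edgesOf colourCount
  rw [← Finset.card_disjSum]
  congr 1
  ext e
  rcases e with t | t <;> simp [colour, Finset.mem_disjSum]

/-- Within one colour class the plus endpoints are distinct (a colour class is a matching). [folklore] -/
theorem SlyWCycle.injOn_plusEnd (C : SlyWCycle n q j) (c : Option (Fin q)) : Set.InjOn C.plusEnd (C.edgesOf c) := by
  intro e he e' he' h
  simp only [edgesOf, Finset.coe_filter, Finset.mem_univ, true_and, Set.mem_setOf_eq] at he he'
  rcases e with t | t <;> rcases e' with t' | t' <;> simp only [plusEnd, colour] at h he he'
  · rw [C.hv h]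
  · -- `v t = v (rot t')` forces `t = rot t'`, contradicting `b t' ≠ a (rot t')`
    have ht := C.hv h
    exact absurd (he'.trans he.symm) (by rw [ht]; exact C.hba t')
  · have ht := C.hv h
    exact absurd (he.trans he'.symm) (by rw [← ht]; exact C.hba t)
  · rw [(finRotate j).injective (C.hv h)]

/-- Within one colour class the minus endpoints are distinct. [folklore] -/
theorem SlyWCycle.injOn_minusEnd (C : SlyWCycle n q j) (c : Option (Fin q)) : Set.InjOn C.minusEnd (C.edgesOf c) := by
  intro e he e' he' h
  simp only [edgesOf, Finset.coe_filter, Finset.mem_univ, true_and, Set.mem_setOf_eq] at he he'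
  rcases e with t | t <;> rcases e' with t' | t' <;> simp only [minusEnd, colour] at h he he'
  · rw [C.hw h]
  · have ht := C.hw h
    subst ht
    exact absurd (he.trans he'.symm) (C.hab t)
  · have ht := C.hw h
    subst ht
    exact absurd (he'.trans he.symm) (C.hab t)
  · rw [C.hw h]

/-- Presence of the cycle, colour by colour. [folklore] -/
theorem SlyWCycle.present_iff (C : SlyWCycle n q j) (σ : Fin q → Equiv.Perm (Fin (n + m'))) (τ : Equiv.Perm (Fin n)) :
    C.Present σ τ ↔
      (∀ c : Fin q, ∀ e ∈ C.edgesOf (some c), σ c (Fin.castAdd m' (C.plusEnd e)) = Fin.castAdd m' (C.minusEnd e)) ∧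
        ∀ e ∈ C.edgesOf none, τ (C.plusEnd e) = C.minusEnd e := by
  unfold Present
  constructor
  · rintro ⟨h1, h2⟩
    constructor
    · intro c e he
      simp only [edgesOf, Finset.mem_filter, Finset.mem_univ, true_and] at he
      rcases e with t | t <;> simp only [colour] at he <;> simp only [plusEnd, minusEnd]
      · have := h1 t; rw [he] at this; exact this
      · have := h2 t; rw [he] at this; exact this
    · intro e he
      simp only [edgesOf, Finset.mem_filter, Finset.mem_univ, true_and] at he
      rcases e with t | t <;> simp only [colour] at he <;> simp only [plusEnd, minusEnd]
      · have := h1 t; rw [he] at this; exact this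
      · have := h2 t; rw [he] at this; exact this
  · rintro ⟨h1, h2⟩
    constructor
    · intro t
      cases hc : C.a t with
      | none =>
        have := h2 (Sum.inl t) (by simp [edgesOf, colour, hc])
        simpa [SlyEdgePresent, plusEnd, minusEnd] using this
      | some c =>
        have := h1 c (Sum.inl t) (by simp [edgesOf, colour, hc])
        simpa [SlyEdgePresent, plusEnd, minusEnd] using this
    · intro t
      cases hc : C.b t with
      | none =>
        have := h2 (Sum.inr t) (by simp [edgesOf, colour, hc])
        simpa [SlyEdgePresent, plusEnd, minusEnd] using this
      | some c =>
        have := h1 c (Sum.inr t) (by simp [edgesOf, colour, hc])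
        simpa [SlyEdgePresent, plusEnd, minusEnd] using this

open scoped Classical in
/-- **Presence probability of one coloured cycle** (counting form):
`#{(σ,τ) : C ⊆ G̃(σ,τ)} = Π_{c} (n + m' - k_c)! · (n - k_τ)!`, `k_c` the number of edges of colour `c`.
[cite: Sly2010, Lemma 3.7 (proof: "P1 = (1+o(1)) n^{-i}")] -/
theorem SlyWCycle.card_present (C : SlyWCycle n q j) :
    Fintype.card {ω : (Fin q → Equiv.Perm (Fin (n + m'))) × Equiv.Perm (Fin n) // C.Present ω.1 ω.2} =
      (∏ c : Fin q, (n + m' - C.colourCount (some c)).factorial) * (n - C.colourCount none).factorial := by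
  -- factorise over the colours
  have e1 : {ω : (Fin q → Equiv.Perm (Fin (n + m'))) × Equiv.Perm (Fin n) // C.Present ω.1 ω.2} ≃
      {σ : Fin q → Equiv.Perm (Fin (n + m')) //
          ∀ c : Fin q, ∀ e ∈ C.edgesOf (some c), σ c (Fin.castAdd m' (C.plusEnd e)) = Fin.castAdd m' (C.minusEnd e)} ×
        {τ : Equiv.Perm (Fin n) // ∀ e ∈ C.edgesOf none, τ (C.plusEnd e) = C.minusEnd e} :=
    { toFun := fun ω => ⟨⟨ω.1.1, ((C.present_iff _ _).1 ω.2).1⟩, ⟨ω.1.2, ((C.present_iff _ _).1 ω.2).2⟩⟩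
      invFun := fun p => ⟨(p.1.1, p.2.1), (C.present_iff _ _).2 ⟨p.1.2, p.2.2⟩⟩
      left_inv := fun ω => rfl
      right_inv := fun p => rfl }
  have e2 : {σ : Fin q → Equiv.Perm (Fin (n + m')) //
      ∀ c : Fin q, ∀ e ∈ C.edgesOf (some c), σ c (Fin.castAdd m' (C.plusEnd e)) = Fin.castAdd m' (C.minusEnd e)} ≃
      ∀ c : Fin q, {π : Equiv.Perm (Fin (n + m')) // ∀ e ∈ C.edgesOf (some c), π (Fin.castAdd m' (C.plusEnd e)) = Fin.castAdd m' (C.minusEnd e)} :=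
    { toFun := fun σ c => ⟨σ.1 c, σ.2 c⟩
      invFun := fun f => ⟨fun c => (f c).1, fun c => (f c).2⟩
      left_inv := fun σ => rfl
      right_inv := fun f => rfl }
  rw [Fintype.card_congr e1, Fintype.card_prod, Fintype.card_congr e2, Fintype.card_pi]
  congr 1
  · refine Finset.prod_congr rfl fun c _ => ?_
    have h := card_perm_forall_mem_apply_eq (C.edgesOf (some c)) (fun e => Fin.castAdd m' (C.plusEnd e)) (fun e => Fin.castAdd m' (C.minusEnd e))
      (fun e he e' he' h => C.injOn_plusEnd (some c) he he' (Fin.castAdd_injective _ _ h))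
      (fun e he e' he' h => C.injOn_minusEnd (some c) he he' (Fin.castAdd_injective _ _ h))
    rw [Fintype.card_fin, C.card_edgesOf] at h
    convert h using 2
  · have h := card_perm_forall_mem_apply_eq (C.edgesOf none) C.plusEnd C.minusEnd (C.injOn_plusEnd none) (C.injOn_minusEnd none)
    rw [Fintype.card_fin, C.card_edgesOf] at h
    convert h using 2

end CycleCount

section CycleFirstMoment

variable {n m' q j : ℕ}

/-- `SlyWCycle` as a subtype of a product of function types (for finiteness and counting). [folklore] -/
def slyWCycleEquiv (n q j : ℕ) :
    SlyWCycle n q j ≃ {p : (Fin j → Fin n) × (Fin j → Fin n) × (Fin j → Option (Fin q)) × (Fin j → Option (Fin q)) //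
      Function.Injective p.1 ∧ Function.Injective p.2.1 ∧ (∀ t, p.2.2.1 t ≠ p.2.2.2 t) ∧ ∀ t, p.2.2.2 t ≠ p.2.2.1 (finRotate j t)} where
  toFun C := ⟨(C.v, C.w, C.a, C.b), C.hv, C.hw, C.hab, C.hba⟩
  invFun p := ⟨p.1.1, p.1.2.1, p.1.2.2.1, p.1.2.2.2, p.2.1, p.2.2.1, p.2.2.2.1, p.2.2.2.2⟩
  left_inv C := by cases C; rfl
  right_inv p := by rfl

/-- Finiteness of the type of rooted oriented cycles. [folklore] -/
noncomputable instance instFintypeSlyWCycle (n q j : ℕ) : Fintype (SlyWCycle n q j) := by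
  classical exact Fintype.ofEquiv _ (slyWCycleEquiv n q j).symm

open scoped Classical in
/-- The number `R_{2j}(σ,τ)` of rooted oriented coloured `2j`-cycles inside `W` present in `G̃(σ,τ)`
(`= 2j · X_{2j}`). [cite: Sly2010, §3.2 (`X_i`)] -/
noncomputable def slyRootedCycles (n m' q j : ℕ) (σ : Fin q → Equiv.Perm (Fin (n + m'))) (τ : Equiv.Perm (Fin n)) : ℕ :=
  (univ.filter fun C : SlyWCycle n q j => C.Present σ τ).card

open scoped Classical in
/-- **Exact first moment of the rooted cycle count**:
`Σ_{(σ,τ)} R_{2j}(σ,τ) = Σ_C Π_c (n+m'-k_c(C))! (n-k_τ(C))!`. [cite: Sly2010, Lemma 3.7 (first moment)] -/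
theorem sum_slyRootedCycles (n m' q j : ℕ) :
    ∑ ω : (Fin q → Equiv.Perm (Fin (n + m'))) × Equiv.Perm (Fin n), slyRootedCycles n m' q j ω.1 ω.2 =
      ∑ C : SlyWCycle n q j, (∏ c : Fin q, (n + m' - C.colourCount (some c)).factorial) * (n - C.colourCount none).factorial := by
  unfold slyRootedCycles
  -- double counting
  have h : ∀ ω : (Fin q → Equiv.Perm (Fin (n + m'))) × Equiv.Perm (Fin n),
      (univ.filter fun C : SlyWCycle n q j => C.Present ω.1 ω.2).card = ∑ C : SlyWCycle n q j, if C.Present ω.1 ω.2 then 1 else 0 := by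
    intro ω; rw [Finset.card_filter]
  simp_rw [h]
  rw [Finset.sum_comm]
  refine Finset.sum_congr rfl fun C _ => ?_
  rw [← C.card_present, ← Finset.card_filter, Fintype.card_subtype]

end CycleFirstMoment

section Patterns

variable {n m' q j : ℕ}

/-- A **colour pattern** `ξ` of a rooted oriented `2j`-cycle (Sly's `ξ` without the vertex 2-colouring):
the colours `(a_t, b_t)` with consecutive edges coloured differently. [cite: Sly2010, Lemma 3.8 (proof, "Denote by `ξ` …")] -/
def SlyColourPattern (q j : ℕ) : Type :=
  {ab : (Fin j → Option (Fin q)) × (Fin j → Option (Fin q)) // (∀ t, ab.1 t ≠ ab.2 t) ∧ ∀ t, ab.2 t ≠ ab.1 (finRotate j t)}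

/-- Finiteness of the type of colour patterns. [folklore] -/
noncomputable instance instFintypeSlyColourPattern (q j : ℕ) : Fintype (SlyColourPattern q j) := by
  classical unfold SlyColourPattern; infer_instance

/-- The colour pattern of a cycle. [folklore] -/
def SlyWCycle.pattern (C : SlyWCycle n q j) : SlyColourPattern q j := ⟨(C.a, C.b), C.hab, C.hba⟩

/-- The number of edges of colour `c` in a pattern. [folklore] -/
def SlyColourPattern.count (ξ : SlyColourPattern q j) (c : Option (Fin q)) : ℕ :=
  (univ.filter fun t => ξ.1.1 t = c).card + (univ.filter fun t => ξ.1.2 t = c).card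

/-- The colour counts of a cycle are those of its pattern. [folklore] -/
theorem SlyWCycle.colourCount_eq (C : SlyWCycle n q j) (c : Option (Fin q)) : C.colourCount c = C.pattern.count c := rfl

/-- The cycles with a given colour pattern ↔ pairs of injections (positions). [folklore] -/
def slyWCycleFiberEquiv (ξ : SlyColourPattern q j) :
    {C : SlyWCycle n q j // C.pattern = ξ} ≃ (Fin j ↪ Fin n) × (Fin j ↪ Fin n) where
  toFun C := (⟨C.1.v, C.1.hv⟩, ⟨C.1.w, C.1.hw⟩)
  invFun p := ⟨⟨p.1, p.2, ξ.1.1, ξ.1.2, p.1.injective, p.2.injective, ξ.2.1, ξ.2.2⟩, by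
    unfold SlyWCycle.pattern; rfl⟩
  left_inv C := by
    obtain ⟨C, rfl⟩ := C
    rfl
  right_inv p := by rfl

open scoped Classical in
/-- The number of cycles with a given pattern: `(n^{(j)})²` positions. [cite: Sly2010, Lemma 3.8 (proof: positions `ζ`)] -/
theorem card_slyWCycle_pattern (ξ : SlyColourPattern q j) :
    Fintype.card {C : SlyWCycle n q j // C.pattern = ξ} = n.descFactorial j * n.descFactorial j := by
  rw [Fintype.card_congr (slyWCycleFiberEquiv ξ), Fintype.card_prod, Fintype.card_embedding_eq, Fintype.card_fin, Fintype.card_fin]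

open scoped Classical in
/-- Summing a function of the pattern over all cycles. [folklore] -/
theorem sum_slyWCycle_pattern {M : Type*} [AddCommMonoid M] (F : SlyColourPattern q j → M) :
    ∑ C : SlyWCycle n q j, F C.pattern = ∑ ξ : SlyColourPattern q j, (n.descFactorial j * n.descFactorial j) • F ξ := by
  rw [← Finset.sum_fiberwise_of_maps_to (s := (univ : Finset (SlyWCycle n q j))) (t := (univ : Finset (SlyColourPattern q j)))
    (g := SlyWCycle.pattern) (fun _ _ => Finset.mem_univ _)]
  refine Finset.sum_congr rfl fun ξ _ => ?_
  rw [Finset.sum_congr rfl (fun C hC => by rw [(Finset.mem_filter.1 hC).2] : ∀ C ∈ univ.filter (fun C : SlyWCycle n q j => C.pattern = ξ), F C.pattern = F ξ),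
    Finset.sum_const, ← card_slyWCycle_pattern ξ, ← Fintype.card_subtype]

open scoped Classical in
/-- **First moment of the rooted cycle count in pattern form**:
`Σ_{(σ,τ)} R_{2j} = (n^{(j)})² Σ_ξ Π_c (n+m'-k_c(ξ))! (n-k_τ(ξ))!`. [cite: Sly2010, Lemma 3.7] -/
theorem sum_slyRootedCycles_pattern (n m' q j : ℕ) :
    ∑ ω : (Fin q → Equiv.Perm (Fin (n + m'))) × Equiv.Perm (Fin n), slyRootedCycles n m' q j ω.1 ω.2 =
      ∑ ξ : SlyColourPattern q j, (n.descFactorial j * n.descFactorial j) *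
        ((∏ c : Fin q, (n + m' - ξ.count (some c)).factorial) * (n - ξ.count none).factorial) := by
  rw [sum_slyRootedCycles]
  simp_rw [SlyWCycle.colourCount_eq]
  rw [sum_slyWCycle_pattern (fun ξ : SlyColourPattern q j => (∏ c : Fin q, (n + m' - ξ.count (some c)).factorial) * (n - ξ.count none).factorial)]
  simp only [smul_eq_mul]

end Patterns

section PatternArithmetic

variable {q j : ℕ}

/-- Every edge has exactly one colour: `Σ_c k_c(ξ) = 2j`. [folklore] -/
theorem SlyColourPattern.sum_count (ξ : SlyColourPattern q j) : ∑ c : Option (Fin q), ξ.count c = 2 * j := by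
  classical
  unfold SlyColourPattern.count
  rw [Finset.sum_add_distrib]
  have h : ∀ f : Fin j → Option (Fin q), ∑ c : Option (Fin q), (univ.filter fun t => f t = c).card = j := by
    intro f
    rw [← Finset.card_eq_sum_card_fiberwise (f := f) (s := univ) (t := univ) (fun _ _ => Finset.mem_univ _)]
    simp
  rw [h, h]; ring

/-- In particular each colour class has at most `2j` edges. [folklore] -/
theorem SlyColourPattern.count_le (ξ : SlyColourPattern q j) (c : Option (Fin q)) : ξ.count c ≤ 2 * j := by
  classical
  rw [← ξ.sum_count]
  exact Finset.single_le_sum (f := fun c => ξ.count c) (fun _ _ => Nat.zero_le _) (Finset.mem_univ c)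

/-- `(N-k)!/N! = 1/N^{(k)}` as a real identity: `(N-k)! · N^{(k)} = N!` for `k ≤ N`. [folklore] -/
theorem factorial_sub_mul_descFactorial {N k : ℕ} (hk : k ≤ N) : (N - k).factorial * N.descFactorial k = N.factorial :=
  Nat.factorial_mul_descFactorial hk

end PatternArithmetic

section TermBounds

variable {q j : ℕ}

/-- The contribution of one pattern to `E R_{2j}`: `T(ξ) = (n^{(j)})² / (Π_c N^{(k_c)} · n^{(k_τ)})`, `N = n + m'`. [folklore] -/
noncomputable def slyPatternTerm (n m' : ℕ) (ξ : SlyColourPattern q j) : ℝ :=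
  (n.descFactorial j : ℝ) ^ 2 / ((∏ c : Fin q, ((n + m').descFactorial (ξ.count (some c)) : ℝ)) * (n.descFactorial (ξ.count none) : ℝ))

/-- **`E R_{2j} = Σ_ξ T(ξ)`**: the exact first moment of the rooted cycle count, normalised.
[cite: Sly2010, Lemma 3.7] -/
theorem avg_slyRootedCycles (n m' q j : ℕ) (hn : 2 * j ≤ n) :
    (∑ ω : (Fin q → Equiv.Perm (Fin (n + m'))) × Equiv.Perm (Fin n), (slyRootedCycles n m' q j ω.1 ω.2 : ℝ)) /
        ((((n + m').factorial : ℝ) ^ q) * (n.factorial : ℝ)) = ∑ ξ : SlyColourPattern q j, slyPatternTerm n m' ξ := by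
  have hN : (0 : ℝ) < (((n + m').factorial : ℝ) ^ q) * (n.factorial : ℝ) := by
    have h1 : (0 : ℝ) < (n + m').factorial := by exact_mod_cast Nat.factorial_pos _
    have h2 : (0 : ℝ) < n.factorial := by exact_mod_cast Nat.factorial_pos _
    positivity
  rw [div_eq_iff hN.ne', Finset.sum_mul]
  have h := sum_slyRootedCycles_pattern n m' q j
  have h' : (∑ ω : (Fin q → Equiv.Perm (Fin (n + m'))) × Equiv.Perm (Fin n), (slyRootedCycles n m' q j ω.1 ω.2 : ℝ)) =
      ∑ ξ : SlyColourPattern q j, ((n.descFactorial j * n.descFactorial j : ℕ) : ℝ) *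
        ((∏ c : Fin q, ((n + m' - ξ.count (some c)).factorial : ℝ)) * ((n - ξ.count none).factorial : ℝ)) := by
    exact_mod_cast h
  rw [h']
  refine Finset.sum_congr rfl fun ξ _ => ?_
  -- `(N - k)! = N! / N^{(k)}` for each colour
  have hkc : ∀ c : Option (Fin q), ξ.count c ≤ n := fun c => (ξ.count_le c).trans hn
  have hfac : ∀ (N k : ℕ), k ≤ N → ((N - k).factorial : ℝ) = (N.factorial : ℝ) / (N.descFactorial k : ℝ) := by
    intro N k hk
    have hpos : (0 : ℝ) < N.descFactorial k := by exact_mod_cast Nat.descFactorial_pos.2 hk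
    rw [eq_div_iff hpos.ne']
    exact_mod_cast factorial_sub_mul_descFactorial hk
  have hprod : (∏ c : Fin q, ((n + m' - ξ.count (some c)).factorial : ℝ)) =
      ∏ c : Fin q, (((n + m').factorial : ℝ) / ((n + m').descFactorial (ξ.count (some c)) : ℝ)) :=
    Finset.prod_congr rfl fun c _ => hfac _ _ ((hkc (some c)).trans (Nat.le_add_right n m'))
  rw [hprod, hfac n (ξ.count none) (hkc none), Finset.prod_div_distrib, Finset.prod_const, Finset.card_univ, Fintype.card_fin]
  unfold slyPatternTerm
  have hP : (∏ c : Fin q, ((n + m').descFactorial (ξ.count (some c)) : ℝ)) ≠ 0 :=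
    Finset.prod_ne_zero_iff.2 fun c _ => by
      exact_mod_cast (Nat.descFactorial_pos.2 ((hkc (some c)).trans (Nat.le_add_right n m'))).ne'
  have hD : (n.descFactorial (ξ.count none) : ℝ) ≠ 0 := by exact_mod_cast (Nat.descFactorial_pos.2 (hkc none)).ne'
  push_cast
  field_simp

end TermBounds

section TermBounds2

variable {q j : ℕ}

/-- **Two-sided bounds on a pattern's contribution**: for `2j < n`,
`((n-j)/(n+m'))^{2j} ≤ T(ξ) ≤ (n/(n-2j))^{2j}`; hence `T(ξ) → 1` when `j² + j m' = o(n)`, which is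
the content of "`P1 = (1+o(1)) n^{-i}`" together with the `(n^{(j)})²` positions.
[cite: Sly2010, Lemma 3.7 (proof)] -/
theorem slyPatternTerm_bounds (n m' : ℕ) (ξ : SlyColourPattern q j) (hn : 2 * j < n) :
    (((n : ℝ) - j) / ((n : ℝ) + m')) ^ (2 * j) ≤ slyPatternTerm n m' ξ ∧
      slyPatternTerm n m' ξ ≤ ((n : ℝ) / ((n : ℝ) - 2 * j)) ^ (2 * j) := by
  have hkc : ∀ c : Option (Fin q), ξ.count c ≤ 2 * j := ξ.count_le
  have hsum := ξ.sum_count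
  have hn0 : (0 : ℝ) < n := by exact_mod_cast (show 0 < n by omega)
  have hnj : (0 : ℝ) < (n : ℝ) - j := by
    have : (j : ℝ) < n := by exact_mod_cast (show j < n by omega)
    linarith
  have hn2j : (0 : ℝ) < (n : ℝ) - 2 * j := by
    have : ((2 * j : ℕ) : ℝ) < n := by exact_mod_cast hn
    push_cast at this; linarith
  have hN : (n : ℝ) ≤ (n : ℝ) + m' := by have := (Nat.cast_nonneg m' : (0:ℝ) ≤ m'); linarith
  -- bounds on the descending factorials
  have hnum_lo : ((n : ℝ) - j) ^ j ≤ (n.descFactorial j : ℝ) := by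
    have h := Nat.pow_sub_le_descFactorial n j
    have h' : (((n + 1 - j) ^ j : ℕ) : ℝ) ≤ (n.descFactorial j : ℝ) := by exact_mod_cast h
    refine le_trans ?_ h'
    push_cast [show j ≤ n + 1 by omega]
    exact pow_le_pow_left₀ hnj.le (by linarith) j
  have hnum_hi : (n.descFactorial j : ℝ) ≤ (n : ℝ) ^ j := by exact_mod_cast Nat.descFactorial_le_pow n j
  have hden_hi : ∀ (N k : ℕ), (N.descFactorial k : ℝ) ≤ (N : ℝ) ^ k := fun N k => by exact_mod_cast Nat.descFactorial_le_pow N k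
  have hden_lo : ∀ (N k : ℕ), k ≤ 2 * j → n ≤ N → ((n : ℝ) - 2 * j) ^ k ≤ (N.descFactorial k : ℝ) := by
    intro N k hk hNn
    have h := Nat.pow_sub_le_descFactorial N k
    have h' : (((N + 1 - k : ℕ) : ℝ)) ^ k ≤ (N.descFactorial k : ℝ) := by exact_mod_cast h
    refine le_trans (pow_le_pow_left₀ hn2j.le ?_ k) h'
    rw [Nat.cast_sub (by omega : k ≤ N + 1)]
    push_cast
    have : ((k : ℕ) : ℝ) ≤ 2 * j := by exact_mod_cast hk
    have : (n : ℝ) ≤ N := by exact_mod_cast hNn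
    linarith
  -- the denominator `D = Π_c N^{(k_c)} · n^{(k_τ)}`
  set D : ℝ := (∏ c : Fin q, ((n + m').descFactorial (ξ.count (some c)) : ℝ)) * (n.descFactorial (ξ.count none) : ℝ) with hD
  have hD_hi : D ≤ ((n : ℝ) + m') ^ (2 * j) := by
    have h1 : (∏ c : Fin q, ((n + m').descFactorial (ξ.count (some c)) : ℝ)) ≤ ∏ c : Fin q, ((n : ℝ) + m') ^ ξ.count (some c) :=
      Finset.prod_le_prod (fun c _ => Nat.cast_nonneg _) fun c _ => by
        have := hden_hi (n + m') (ξ.count (some c)); push_cast at this; exact this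
    have h2 : (n.descFactorial (ξ.count none) : ℝ) ≤ ((n : ℝ) + m') ^ ξ.count none :=
      (hden_hi n _).trans (pow_le_pow_left₀ hn0.le hN _)
    calc D ≤ (∏ c : Fin q, ((n : ℝ) + m') ^ ξ.count (some c)) * ((n : ℝ) + m') ^ ξ.count none :=
          mul_le_mul h1 h2 (Nat.cast_nonneg _) (Finset.prod_nonneg fun c _ => by positivity)
      _ = ((n : ℝ) + m') ^ (2 * j) := by
          rw [Finset.prod_pow_eq_pow_sum, ← pow_add, ← hsum, Fintype.sum_option]; ring_nf
  have hD_lo : ((n : ℝ) - 2 * j) ^ (2 * j) ≤ D := by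
    have h1 : (∏ c : Fin q, ((n : ℝ) - 2 * j) ^ ξ.count (some c)) ≤ ∏ c : Fin q, ((n + m').descFactorial (ξ.count (some c)) : ℝ) :=
      Finset.prod_le_prod (fun c _ => by positivity) fun c _ => hden_lo _ _ (hkc _) (Nat.le_add_right n m')
    have h2 : ((n : ℝ) - 2 * j) ^ ξ.count none ≤ (n.descFactorial (ξ.count none) : ℝ) := hden_lo _ _ (hkc _) le_rfl
    calc ((n : ℝ) - 2 * j) ^ (2 * j) = (∏ c : Fin q, ((n : ℝ) - 2 * j) ^ ξ.count (some c)) * ((n : ℝ) - 2 * j) ^ ξ.count none := by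
          rw [Finset.prod_pow_eq_pow_sum, ← pow_add, ← hsum, Fintype.sum_option]; ring_nf
      _ ≤ D := mul_le_mul h1 h2 (by positivity) (Finset.prod_nonneg fun c _ => Nat.cast_nonneg _)
  have hD0 : 0 < D := lt_of_lt_of_le (by positivity) hD_lo
  unfold slyPatternTerm
  rw [← hD]
  constructor
  · -- lower bound
    rw [div_pow, div_le_div_iff₀ (by positivity) hD0]
    calc ((n : ℝ) - j) ^ (2 * j) * D ≤ ((n : ℝ) - j) ^ (2 * j) * ((n : ℝ) + m') ^ (2 * j) :=
          mul_le_mul_of_nonneg_left hD_hi (by positivity)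
      _ = (((n : ℝ) - j) ^ j) ^ 2 * ((n : ℝ) + m') ^ (2 * j) := by rw [← pow_mul, mul_comm j 2]
      _ ≤ (n.descFactorial j : ℝ) ^ 2 * ((n : ℝ) + m') ^ (2 * j) :=
          mul_le_mul_of_nonneg_right (pow_le_pow_left₀ (by positivity) hnum_lo 2) (by positivity)
  · -- upper bound
    rw [div_pow, div_le_div_iff₀ hD0 (by positivity)]
    calc (n.descFactorial j : ℝ) ^ 2 * ((n : ℝ) - 2 * j) ^ (2 * j) ≤ ((n : ℝ) ^ j) ^ 2 * D :=
          mul_le_mul (pow_le_pow_left₀ (Nat.cast_nonneg _) hnum_hi 2) hD_lo (by positivity) (by positivity)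
      _ = (n : ℝ) ^ (2 * j) * D := by rw [← pow_mul, mul_comm j 2]

end TermBounds2

section ChromaticCycle

variable {κ : Type*} [Fintype κ] [DecidableEq κ]

/-- Proper colourings of the path `0 — 1 — ⋯ — L` (length `L+1` sequences with adjacent entries distinct). [folklore] -/
def pathProper (κ : Type*) (L : ℕ) : Type _ := {f : Fin (L + 1) → κ // ∀ i : Fin L, f (Fin.castSucc i) ≠ f i.succ}

/-- Proper colourings of the cycle `C_{L+1}` (cyclically adjacent entries distinct). [folklore] -/
def cycleProper (κ : Type*) (L : ℕ) : Type _ := {f : Fin (L + 1) → κ // ∀ i : Fin (L + 1), f i ≠ f (finRotate (L + 1) i)}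

/-- Finiteness of proper path colourings. [folklore] -/
instance instFintypePathProper (L : ℕ) : Fintype (pathProper κ L) := by unfold pathProper; infer_instance
/-- Finiteness of proper cycle colourings. [folklore] -/
instance instFintypeCycleProper (L : ℕ) : Fintype (cycleProper κ L) := by unfold cycleProper; infer_instance

/-- Extending a proper path colouring by one vertex. [folklore] -/
def pathProperSuccEquiv (L : ℕ) : pathProper κ (L + 1) ≃ {p : pathProper κ L × κ // p.2 ≠ p.1.1 (Fin.last L)} where
  toFun f := ⟨(⟨fun i => f.1 (Fin.castSucc i), fun i => f.2 (Fin.castSucc i)⟩, f.1 (Fin.last (L + 1))),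
    fun h => f.2 (Fin.last L) (by rw [Fin.succ_last]; exact h.symm)⟩
  invFun p := ⟨Fin.snoc p.1.1.1 p.1.2, fun i => by
    refine Fin.lastCases ?_ (fun i => ?_) i
    · rw [Fin.succ_last, Fin.snoc_last, Fin.snoc_castSucc]; exact fun h => p.2 h.symm
    · rw [← Fin.castSucc_succ, Fin.snoc_castSucc, Fin.snoc_castSucc]; exact p.1.1.2 i⟩
  left_inv f := by
    apply Subtype.ext
    funext i
    refine Fin.lastCases ?_ (fun i => ?_) i
    · simp [Fin.snoc_last]
    · simp [Fin.snoc_castSucc]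
  right_inv p := by
    apply Subtype.ext
    apply Prod.ext
    · apply Subtype.ext
      funext i
      simp [Fin.snoc_castSucc]
    · simp [Fin.snoc_last]

omit [DecidableEq κ] in
/-- Counting pairs `(a, c)` with `c ≠ g a`: `|A| (k - 1)`. [folklore] -/
theorem card_subtype_prod_ne {A : Type*} [Fintype A] [DecidableEq κ] (g : A → κ) :
    Fintype.card {p : A × κ // p.2 ≠ g p.1} = Fintype.card A * (Fintype.card κ - 1) := by
  classical
  rw [Fintype.card_subtype, Finset.card_filter, Fintype.sum_prod_type]
  have : ∀ a : A, (∑ c : κ, if c ≠ g a then 1 else 0) = Fintype.card κ - 1 := by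
    intro a
    rw [← Finset.card_filter, Finset.filter_ne', Finset.card_erase_of_mem (Finset.mem_univ _), Finset.card_univ]
  simp_rw [this]
  rw [Finset.sum_const, Finset.card_univ, smul_eq_mul]

/-- `#(proper path colourings of length L+1) = k (k-1)^L`. [folklore] -/
theorem card_pathProper (L : ℕ) : Fintype.card (pathProper κ L) = Fintype.card κ * (Fintype.card κ - 1) ^ L := by
  induction L with
  | zero =>
    rw [pow_zero, mul_one]
    unfold pathProper
    rw [Fintype.card_congr (Equiv.subtypeUnivEquiv (fun f => fun i => i.elim0)), Fintype.card_fun, Fintype.card_fin, pow_one]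
  | succ L ih =>
    rw [Fintype.card_congr (pathProperSuccEquiv L)]
    refine (card_subtype_prod_ne (fun f : pathProper κ L => f.1 (Fin.last L))).trans ?_
    rw [ih, pow_succ]
    ring

end ChromaticCycle

section ChromaticCycle2

variable {κ : Type*} [Fintype κ] [DecidableEq κ]

/-- A proper path colouring of length `L+2` whose ends differ is a proper colouring of the cycle `C_{L+2}`. [folklore] -/
def pathProperNeEquiv (L : ℕ) :
    {f : pathProper κ (L + 1) // f.1 (Fin.last (L + 1)) ≠ f.1 0} ≃ cycleProper κ (L + 1) where
  toFun f := ⟨f.1.1, fun i => by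
    rw [finRotate_apply]
    refine Fin.lastCases ?_ (fun i => ?_) i
    · rw [Fin.last_add_one]; exact f.2
    · rw [Fin.coeSucc_eq_succ]; exact f.1.2 i⟩
  invFun g := ⟨⟨g.1, fun i => by
    have := g.2 (Fin.castSucc i); rwa [finRotate_apply, Fin.coeSucc_eq_succ] at this⟩, by
    have := g.2 (Fin.last (L + 1)); rwa [finRotate_apply, Fin.last_add_one] at this⟩
  left_inv f := rfl
  right_inv g := rfl

/-- A proper path colouring of length `L+2` whose ends agree is a proper colouring of the cycle `C_{L+1}`
(drop the last vertex). [folklore] -/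
def pathProperEqEquiv (L : ℕ) :
    {f : pathProper κ (L + 1) // f.1 (Fin.last (L + 1)) = f.1 0} ≃ cycleProper κ L where
  toFun f := ⟨fun i => f.1.1 (Fin.castSucc i), fun i => by
    rw [finRotate_apply]
    refine Fin.lastCases ?_ (fun i => ?_) i
    · rw [Fin.last_add_one]
      show f.1.1 (Fin.castSucc (Fin.last L)) ≠ f.1.1 (Fin.castSucc 0)
      rw [Fin.castSucc_zero]
      intro h
      apply f.1.2 (Fin.last L)
      rw [Fin.succ_last, f.2]
      exact h
    · rw [Fin.coeSucc_eq_succ]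
      show f.1.1 (Fin.castSucc (Fin.castSucc i)) ≠ f.1.1 (Fin.castSucc i.succ)
      exact f.1.2 (Fin.castSucc i)⟩
  invFun g := ⟨⟨(Fin.snoc g.1 (g.1 0) : Fin (L + 2) → κ), fun i => by
    refine Fin.lastCases ?_ (fun i => ?_) i
    · rw [Fin.succ_last, Fin.snoc_last, Fin.snoc_castSucc]
      have := g.2 (Fin.last L); rwa [finRotate_apply, Fin.last_add_one] at this
    · show (Fin.snoc g.1 (g.1 0) : Fin (L + 2) → κ) (Fin.castSucc (Fin.castSucc i)) ≠
        (Fin.snoc g.1 (g.1 0) : Fin (L + 2) → κ) (Fin.castSucc i.succ)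
      rw [Fin.snoc_castSucc, Fin.snoc_castSucc]
      have := g.2 (Fin.castSucc i); rwa [finRotate_apply, Fin.coeSucc_eq_succ] at this⟩, by
    show (Fin.snoc g.1 (g.1 0) : Fin (L + 2) → κ) (Fin.last (L + 1)) = (Fin.snoc g.1 (g.1 0) : Fin (L + 2) → κ) (Fin.castSucc 0)
    rw [Fin.snoc_last, Fin.snoc_castSucc]⟩
  left_inv f := by
    apply Subtype.ext; apply Subtype.ext
    funext i
    refine Fin.lastCases ?_ (fun i => ?_) i
    · show (Fin.snoc (fun i => f.1.1 (Fin.castSucc i)) (f.1.1 (Fin.castSucc 0)) : Fin (L + 2) → κ) (Fin.last (L + 1)) = f.1.1 (Fin.last (L + 1))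
      rw [Fin.snoc_last, Fin.castSucc_zero, ← f.2]
    · show (Fin.snoc (fun i => f.1.1 (Fin.castSucc i)) (f.1.1 (Fin.castSucc 0)) : Fin (L + 2) → κ) (Fin.castSucc i) = f.1.1 (Fin.castSucc i)
      rw [Fin.snoc_castSucc]
  right_inv g := by
    apply Subtype.ext
    funext i
    show (Fin.snoc g.1 (g.1 0) : Fin (L + 2) → κ) (Fin.castSucc i) = g.1 i
    rw [Fin.snoc_castSucc]

/-- **Chromatic recurrence for cycles**: `#C_{L+2}-colourings + #C_{L+1}-colourings = k (k-1)^{L+1}`. [folklore] -/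
theorem card_cycleProper_succ_add (L : ℕ) :
    Fintype.card (cycleProper κ (L + 1)) + Fintype.card (cycleProper κ L) = Fintype.card κ * (Fintype.card κ - 1) ^ (L + 1) := by
  classical
  rw [← card_pathProper (κ := κ) (L + 1), ← Fintype.card_congr (pathProperNeEquiv L), ← Fintype.card_congr (pathProperEqEquiv L),
    Fintype.card_subtype_compl, Fintype.card_subtype]
  have hle : (univ.filter fun f : pathProper κ (L + 1) => f.1 (Fin.last (L + 1)) = f.1 0).card ≤ Fintype.card (pathProper κ (L + 1)) :=
    (Finset.card_filter_le _ _).trans (by rw [Finset.card_univ])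
  omega

/-- No proper colouring of the loop `C_1`. [folklore] -/
theorem card_cycleProper_zero : Fintype.card (cycleProper κ 0) = 0 := by
  rw [Fintype.card_eq_zero_iff]
  exact ⟨fun g => g.2 0 (by congr 1)⟩

/-- **Proper `k`-colourings of an even cycle**: `#C_{2j} = (k-1)^{2j} + (k-1)` (`j ≥ 1`). [folklore] -/
theorem card_cycleProper_even (j : ℕ) (hj : 1 ≤ j) :
    Fintype.card (cycleProper κ (2 * j - 1)) = (Fintype.card κ - 1) ^ (2 * j) + (Fintype.card κ - 1) := by
  -- closed form over `ℤ` by induction: `g(L+1) = (k-1)^{L+1} + (-1)^{L+1} (k-1)`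
  have key : ∀ L : ℕ, (Fintype.card (cycleProper κ L) : ℤ) = ((Fintype.card κ : ℤ) - 1) ^ (L + 1) + (-1) ^ (L + 1) * ((Fintype.card κ : ℤ) - 1) := by
    intro L
    induction L with
    | zero => rw [card_cycleProper_zero]; push_cast; ring
    | succ L ih =>
      have h := card_cycleProper_succ_add (κ := κ) L
      rcases Nat.eq_zero_or_pos (Fintype.card κ) with hk | hk
      · -- no colours at all
        have h0 : Fintype.card (cycleProper κ (L + 1)) = 0 := by
          rw [hk, zero_mul] at h; omega
        rw [h0, hk]; push_cast
        rcases Nat.even_or_odd L with ⟨r, hr⟩ | ⟨r, hr⟩ <;> subst hr <;> ring_nf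
      · have h' : (Fintype.card (cycleProper κ (L + 1)) : ℤ) = (Fintype.card κ : ℤ) * ((Fintype.card κ : ℤ) - 1) ^ (L + 1) -
            (Fintype.card (cycleProper κ L) : ℤ) := by
          have : ((Fintype.card (cycleProper κ (L + 1)) + Fintype.card (cycleProper κ L) : ℕ) : ℤ) =
              ((Fintype.card κ * (Fintype.card κ - 1) ^ (L + 1) : ℕ) : ℤ) := by exact_mod_cast h
          push_cast [Nat.one_le_iff_ne_zero.2 hk.ne'] at this
          linarith
        rw [h', ih]; ring
  have h := key (2 * j - 1)
  have h2 : 2 * j - 1 + 1 = 2 * j := by omega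
  rw [h2] at h
  have heven : ((-1 : ℤ)) ^ (2 * j) = 1 := by rw [pow_mul]; norm_num
  rw [heven, one_mul] at h
  rcases Nat.eq_zero_or_pos (Fintype.card κ) with hk | hk
  · -- `k = 0`: both sides vanish… the left is a card, the right is `0^{2j} + 0`? careful: `0 - 1 = 0` in `ℕ`
    have : Fintype.card (cycleProper κ (2 * j - 1)) = 0 := by
      rw [Fintype.card_eq_zero_iff]
      haveI : IsEmpty κ := Fintype.card_eq_zero_iff.1 hk
      exact ⟨fun g => isEmptyElim (g.1 0)⟩
    rw [this, hk]
    simp [zero_pow (by omega : 2 * j ≠ 0)]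
  · have hk1 : ((Fintype.card κ - 1 : ℕ) : ℤ) = (Fintype.card κ : ℤ) - 1 := by push_cast [Nat.one_le_iff_ne_zero.2 hk.ne']; ring
    have : ((Fintype.card (cycleProper κ (2 * j - 1)) : ℕ) : ℤ) = (((Fintype.card κ - 1) ^ (2 * j) + (Fintype.card κ - 1) : ℕ) : ℤ) := by
      push_cast; rw [hk1]; exact h
    exact_mod_cast this

end ChromaticCycle2

section Interleave

variable {q j : ℕ}

/-- Proper colourings of the cycle `C_N`, indexed by `N` directly. [folklore] -/
def cycleProperN (κ : Type*) (N : ℕ) : Type _ := {f : Fin N → κ // ∀ i : Fin N, f i ≠ f (finRotate N i)}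

/-- Finiteness of proper cycle colourings. [folklore] -/
instance instFintypeCycleProperN (κ : Type*) [Fintype κ] [DecidableEq κ] (N : ℕ) : Fintype (cycleProperN κ N) := by
  unfold cycleProperN; infer_instance

/-- Proper `k`-colourings of `C_{2j}`: `(k-1)^{2j} + (k-1)`. [folklore] -/
theorem card_cycleProperN_even (κ : Type*) [Fintype κ] [DecidableEq κ] (j : ℕ) (hj : 1 ≤ j) :
    Fintype.card (cycleProperN κ (j * 2)) = (Fintype.card κ - 1) ^ (2 * j) + (Fintype.card κ - 1) := by
  rw [show j * 2 = 2 * j - 1 + 1 by omega]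
  exact card_cycleProper_even j hj

/-- The position `2t + s` of the `s`-th edge at step `t` (`s = 0`: `v_t — w_t`, `s = 1`: `w_t — v_{t+1}`). [folklore] -/
def slyEdgeIndex (j : ℕ) (t : Fin j) (s : Fin 2) : Fin (j * 2) := finProdFinEquiv (t, s)

/-- The value of `slyEdgeIndex`. [folklore] -/
theorem slyEdgeIndex_val (t : Fin j) (s : Fin 2) : (slyEdgeIndex j t s : ℕ) = (s : ℕ) + 2 * t := by
  simp [slyEdgeIndex, finProdFinEquiv]

/-- The successor of position `2t` is `2t+1`. [folklore] -/
theorem finRotate_slyEdgeIndex_zero (t : Fin j) : finRotate (j * 2) (slyEdgeIndex j t 0) = slyEdgeIndex j t 1 := by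
  have ht := t.isLt
  apply Fin.ext
  simp only [finRotate_apply, Fin.val_add, slyEdgeIndex_val, Fin.val_one', Fin.val_zero]
  rw [Nat.mod_eq_of_lt (show 1 < j * 2 by omega), Nat.mod_eq_of_lt (show 0 + 2 * (t : ℕ) + 1 < j * 2 by omega)]
  ring

/-- The successor of position `2t+1` is `2(t+1)` (cyclically). [folklore] -/
theorem finRotate_slyEdgeIndex_one (t : Fin j) :
    finRotate (j * 2) (slyEdgeIndex j t 1) = slyEdgeIndex j (finRotate j t) 0 := by
  have ht := t.isLt
  apply Fin.ext
  simp only [finRotate_apply, Fin.val_add, slyEdgeIndex_val, Fin.val_one', Fin.val_zero]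
  rw [Nat.mod_eq_of_lt (show 1 < j * 2 by omega)]
  rcases Nat.lt_or_ge ((t : ℕ) + 1) j with h | h
  · rw [Nat.mod_eq_of_lt (show 1 < j by omega), Nat.mod_eq_of_lt h, Nat.mod_eq_of_lt (show 1 + 2 * (t : ℕ) + 1 < j * 2 by omega)]
    ring
  · have e : 1 + 2 * (t : ℕ) + 1 = j * 2 := by omega
    rw [e, Nat.mod_self]
    rcases Nat.lt_or_ge 1 j with h1 | h1
    · rw [Nat.mod_eq_of_lt h1, show (t : ℕ) + 1 = j by omega, Nat.mod_self]
    · have hj1 : j = 1 := by omega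
      subst hj1
      simp

/-- Interleaving the two colour sequences of a pattern into one cyclic sequence of length `2j`. [folklore] -/
def slyInterleave {K : Type*} (a b : Fin j → K) : Fin (j * 2) → K :=
  fun i => if (finProdFinEquiv.symm i).2 = 0 then a (finProdFinEquiv.symm i).1 else b (finProdFinEquiv.symm i).1

/-- Even positions of the interleaving. [folklore] -/
theorem slyInterleave_zero {K : Type*} (a b : Fin j → K) (t : Fin j) : slyInterleave a b (slyEdgeIndex j t 0) = a t := by
  simp [slyInterleave, slyEdgeIndex]

/-- Odd positions of the interleaving. [folklore] -/
theorem slyInterleave_one {K : Type*} (a b : Fin j → K) (t : Fin j) : slyInterleave a b (slyEdgeIndex j t 1) = b t := by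
  simp [slyInterleave, slyEdgeIndex]

/-- Every position is `slyEdgeIndex j t s`. [folklore] -/
theorem exists_slyEdgeIndex (i : Fin (j * 2)) : ∃ (t : Fin j) (s : Fin 2), i = slyEdgeIndex j t s :=
  ⟨(finProdFinEquiv.symm i).1, (finProdFinEquiv.symm i).2, by
    unfold slyEdgeIndex
    rw [show ((finProdFinEquiv.symm i).1, (finProdFinEquiv.symm i).2) = finProdFinEquiv.symm i from rfl, Equiv.apply_symm_apply]⟩

/-- **Colour patterns of rooted oriented `2j`-cycles are the proper `(q+1)`-colourings of `C_{2j}`.** [folklore] -/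
def slyColourPatternEquiv (q j : ℕ) : SlyColourPattern q j ≃ cycleProperN (Option (Fin q)) (j * 2) where
  toFun ξ := ⟨slyInterleave ξ.1.1 ξ.1.2, fun i => by
    obtain ⟨t, s, rfl⟩ := exists_slyEdgeIndex i
    rcases Fin.exists_fin_two.1 ⟨s, rfl⟩ with h | h <;> rw [h]
    · rw [finRotate_slyEdgeIndex_zero, slyInterleave_zero, slyInterleave_one]; exact ξ.2.1 t
    · rw [finRotate_slyEdgeIndex_one, slyInterleave_one, slyInterleave_zero]; exact ξ.2.2 t⟩
  invFun g := ⟨(fun t => g.1 (slyEdgeIndex j t 0), fun t => g.1 (slyEdgeIndex j t 1)),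
    fun t => by have := g.2 (slyEdgeIndex j t 0); rwa [finRotate_slyEdgeIndex_zero] at this,
    fun t => by have := g.2 (slyEdgeIndex j t 1); rwa [finRotate_slyEdgeIndex_one] at this⟩
  left_inv ξ := by
    apply Subtype.ext
    apply Prod.ext <;> funext t
    · exact slyInterleave_zero _ _ t
    · exact slyInterleave_one _ _ t
  right_inv g := by
    apply Subtype.ext
    funext i
    obtain ⟨t, s, rfl⟩ := exists_slyEdgeIndex i
    rcases Fin.exists_fin_two.1 ⟨s, rfl⟩ with h | h <;> rw [h]
    · exact slyInterleave_zero _ _ t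
    · exact slyInterleave_one _ _ t

/-- **`r(q+1, 2j) = q^{2j} + q`**: the number of colour patterns of rooted oriented `2j`-cycles
(= proper `(q+1)`-edge-colourings of `C_{2j}`), `j ≥ 1`; so `λ_{2j} = (q^{2j} + q)/(2j)`.
[cite: Sly2010, Lemma 3.7 ("`λ_i = r(d,i)/i` where `r(d,i)` counts the number of proper `d`-colourings of a cycle of size `i`")] -/
theorem card_slyColourPattern (q j : ℕ) (hj : 1 ≤ j) : Fintype.card (SlyColourPattern q j) = q ^ (2 * j) + q := by
  classical
  rw [Fintype.card_congr (slyColourPatternEquiv q j)]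
  have h := card_cycleProperN_even (Option (Fin q)) j hj
  rw [Fintype.card_option, Fintype.card_fin, Nat.add_sub_cancel] at h
  convert h using 2

end Interleave

section FirstMomentBounds

/-- **`E R_{2j}` two-sided** (Sly's Lemma 3.7, first moment, quantitative): for `1 ≤ j`, `2j < n`,
`(q^{2j} + q) ((n-j)/(n+m'))^{2j} ≤ E R_{2j} ≤ (q^{2j} + q) (n/(n-2j))^{2j}`; in particular
`E X_{2j} = E R_{2j}/(2j) → λ_{2j} = (q^{2j}+q)/(2j)` as `n → ∞` with `m' = o(n)`.
[cite: Sly2010, Lemma 3.7] -/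
theorem avg_slyRootedCycles_bounds (n m' q j : ℕ) (hj : 1 ≤ j) (hn : 2 * j < n) :
    ((q : ℝ) ^ (2 * j) + q) * (((n : ℝ) - j) / ((n : ℝ) + m')) ^ (2 * j) ≤
        (∑ ω : (Fin q → Equiv.Perm (Fin (n + m'))) × Equiv.Perm (Fin n), (slyRootedCycles n m' q j ω.1 ω.2 : ℝ)) /
          ((((n + m').factorial : ℝ) ^ q) * (n.factorial : ℝ)) ∧
      (∑ ω : (Fin q → Equiv.Perm (Fin (n + m'))) × Equiv.Perm (Fin n), (slyRootedCycles n m' q j ω.1 ω.2 : ℝ)) /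
          ((((n + m').factorial : ℝ) ^ q) * (n.factorial : ℝ)) ≤
        ((q : ℝ) ^ (2 * j) + q) * ((n : ℝ) / ((n : ℝ) - 2 * j)) ^ (2 * j) := by
  classical
  rw [avg_slyRootedCycles n m' q j hn.le]
  have hcard : ((Finset.univ : Finset (SlyColourPattern q j)).card : ℝ) = (q : ℝ) ^ (2 * j) + q := by
    rw [Finset.card_univ, card_slyColourPattern q j hj]; push_cast; ring
  constructor
  · calc ((q : ℝ) ^ (2 * j) + q) * (((n : ℝ) - j) / ((n : ℝ) + m')) ^ (2 * j)
        = ∑ _ξ : SlyColourPattern q j, (((n : ℝ) - j) / ((n : ℝ) + m')) ^ (2 * j) := by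
          rw [Finset.sum_const, nsmul_eq_mul, hcard]
      _ ≤ ∑ ξ : SlyColourPattern q j, slyPatternTerm n m' ξ :=
          Finset.sum_le_sum fun ξ _ => (slyPatternTerm_bounds n m' ξ hn).1
  · calc ∑ ξ : SlyColourPattern q j, slyPatternTerm n m' ξ
        ≤ ∑ _ξ : SlyColourPattern q j, ((n : ℝ) / ((n : ℝ) - 2 * j)) ^ (2 * j) :=
          Finset.sum_le_sum fun ξ _ => (slyPatternTerm_bounds n m' ξ hn).2
      _ = ((q : ℝ) ^ (2 * j) + q) * ((n : ℝ) / ((n : ℝ) - 2 * j)) ^ (2 * j) := by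
          rw [Finset.sum_const, nsmul_eq_mul, hcard]

end FirstMomentBounds

end Literature.Computability.Complexity
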